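import Literature.Probability.RandomPlanarGeometry.SelfAvoidingWalk
import Summits.CriticalPhenomena.SAWScalingLimit.Theses.SAWRenewalTightness

/-!
# Sketch — crux-ideate stmt-CriticalPhenomena-0783 (SubseqIdentification), ideator 1, round 1

First lemmas of the line `two-point-pivot-rigidity`:

* `law_map_eq_of_length_preserving` (L0, the exact lattice engine, PROVED here): any length-preserving
  bijection of the self-avoiding walks of `Ω_δ` from `a` to `b` preserves the critical SAW law
  `Literature.Probability.RandomPlanarGeometry.SAW.law` — "the critical SAW is uniform given its length".
  Two-point pivots (reflection of the sub-walk between the first and the last visit of a lattice line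
  across that line; half-turn of the sub-walk between the first entry of a box and the last exit of
  another about their lattice midpoint; the identity where the image is not a SAW of `Ω_δ`) are such
  bijections (involutions), so every `SAW.law D.carrier δ a b` is invariant under each of them, at every
  mesh, hence so is every subsequential weak limit `μ` of the crux under the continuum moves.
* `law_map_reverse` (reversal, the other inherited exact symmetry; statement only).
-/

noncomputable section

open MeasureTheory Filter Topology Set
open Literature.Probability.RandomPlanarGeometry Literature.Probability.RandomPlanarGeometry.SAW
open Literature.Probability.LatticeModels
open scoped ENNReal NNReal

namespace Summit.CriticalPhenomena.SAWScalingLimit.Cruxes.SubseqIdentification.PivotSketch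

variable {Ω : Set ℂ} {δ : ℝ} {a b : Site 2}

/-- The critical weight is invariant under any length-preserving bijection of the SAWs. [folklore] -/
theorem weight_map_eq_of_length_preserving (T : DomainSAW Ω δ a b → DomainSAW Ω δ a b)
    (hT : Function.Bijective T) (hlen : ∀ γ, (T γ).length = γ.length) :
    (SAW.weight Ω δ a b).map T = SAW.weight Ω δ a b := by
  have hTm : Measurable T := DomainSAW.measurable_of_top T
  refine Measure.ext fun s hs => ?_
  rw [Measure.map_apply hTm hs]
  have key : ∀ (u : Set (DomainSAW Ω δ a b)), SAW.weight Ω δ a b u =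
      ∑' γ, ENNReal.ofReal (criticalFugacity ^ γ.length) * u.indicator 1 γ := by
    intro u
    rw [SAW.weight, Measure.sum_apply _ MeasurableSpace.measurableSet_top]
    refine tsum_congr fun γ => ?_
    rw [Measure.smul_apply, smul_eq_mul, Measure.dirac_apply' _ MeasurableSpace.measurableSet_top]
  rw [key, key]
  let e : DomainSAW Ω δ a b ≃ DomainSAW Ω δ a b := Equiv.ofBijective T hT
  have h1 : ∀ γ, ENNReal.ofReal (criticalFugacity ^ γ.length) * (T ⁻¹' s).indicator 1 γ =
      (fun γ' => ENNReal.ofReal (criticalFugacity ^ γ'.length) * s.indicator 1 γ') (e γ) := by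
    intro γ
    show _ = ENNReal.ofReal (criticalFugacity ^ (T γ).length) * s.indicator 1 (T γ)
    rw [hlen γ]
    congr 1
  rw [tsum_congr h1]
  exact Equiv.tsum_eq e (fun γ' => ENNReal.ofReal (criticalFugacity ^ γ'.length) * s.indicator 1 γ')

/-- **L0 (first lemma of the line, exact lattice engine).** A length-preserving bijection of the SAWs of
`Ω_δ` from `a` to `b` preserves the critical SAW LAW. In particular every two-point pivot involution
does, at every mesh `δ`. [folklore] -/
theorem law_map_eq_of_length_preserving (T : DomainSAW Ω δ a b → DomainSAW Ω δ a b)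
    (hT : Function.Bijective T) (hlen : ∀ γ, (T γ).length = γ.length) :
    (SAW.law Ω δ a b).map T = SAW.law Ω δ a b := by
  rw [SAW.law, Measure.map_smul, weight_map_eq_of_length_preserving T hT hlen]

/-- Reversal of a SAW of `Ω_δ`. [folklore] -/
def reverse (γ : DomainSAW Ω δ a b) : DomainSAW Ω δ b a :=
  ⟨γ.walk.reverse, γ.isPath.reverse⟩

/-- Reversal preserves length. [folklore] -/
@[simp] theorem length_reverse (γ : DomainSAW Ω δ a b) : (reverse γ).length = γ.length := by
  simp [reverse, DomainSAW.length]

/-- The other inherited exact symmetry (statement): the critical SAW law from `a` to `b` pushed forward by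
reversal is the critical SAW law from `b` to `a`. [folklore] -/
def LawMapReverse : Prop :=
  ∀ (Ω : Set ℂ) (δ : ℝ) (a b : Site 2),
    (SAW.law Ω δ a b).map (reverse : DomainSAW Ω δ a b → DomainSAW Ω δ b a) = SAW.law Ω δ b a

/-- **Shape of the continuum rigidity target (L3) as it would dock onto the crux**: if every
subsequential limit is invariant under a family `K` of Markov kernels on `CurveClass ℂ` (the continuum
two-point pivots) and pivot rigidity holds for `(D; a, b)`, the crux follows. Here only the logical
shape is recorded, over existing declarations: `PivotRigidityAt D K` says that a `K`-invariant probability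
law carried by chords of `D` with the right endpoints is the chordal SLE_{8/3} law. [folklore] -/
def PivotRigidityAt (D : DobrushinDomain)
    (K : Set (CurveClass ℂ → Measure (CurveClass ℂ))) : Prop :=
  ∀ μ : Measure (CurveClass ℂ), IsProbabilityMeasure μ →
    (∀ᵐ γ ∂μ, γ.source = D.pt 0 ∧ γ.target = D.pt 1) →
    (∀ k ∈ K, μ.bind k = μ) →
    IsSLELaw ((8 : ℝ≥0) / 3) D μ

end Summit.CriticalPhenomena.SAWScalingLimit.Cruxes.SubseqIdentification.PivotSketch
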